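import Mathlib
import Literature.AlgebraicGeometry.Resolution.TranscendenceDefect
import Literature.AlgebraicGeometry.Resolution.LocalBlowup
import Summits.ResolutionOfSingularities.ResolutionOfSingularities.Theorems.RadicialJungCleanModelsDimOfEmbRes
import HarnessLib

/-!
# Route `RadicialJung`, crux `CleanModels` (stmt-15917), line `Sketch` rev 35, stub 7 `stub_cleanModelsDimGEFour`: LOCAL MONOMIALIZATION of
# finite subsets of a regular model along a valuation, dimension `n + 1`, from embedded resolution of closed subsets of dimension `≤ N` (`n ≤ N`)

Explicit-unit seat `decomp-res-hand-2` g3 (structural hand, stubs 5–7).  OURS; nothing here proves resolution in characteristic `p`.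

`…DimOfLocalMonomialization.lean` (this seat) re-states the local input of stub 7 at LOCAL-UNIFORMIZATION strength: a hypothesis `hMono_d`
(«every finite subset of a finitely generated affine model `A ⊆ O`, regular of dimension `d` at the centre of the zero-dimensional valuation ring
`O`, is monomialized along `O` on a finitely generated refinement `A ⊆ A' ⊆ O` regular at the centre: `z = v ∏ aᵢ^{μᵢ}`, `v` a unit, `(aᵢ)` a
regular system of parameters» — the conclusion shape of Knaf–Kuhlmann 2005 Thm. 1.1 with its monomiality clause).  THIS FILE proves that the
embedded-resolution hypothesis `hEmb_N` of ✓ `cleanModels_dim_of_embeddedResolution` (CJS 2020 Cor. 1.5 shape, bound `N`; printed for `N ≤ 2`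
only) IMPLIES `hMono_{n+1}` for `n ≤ N`:

* `localMonomialization_of_embeddedResolution` — for `A ⊆ O` as above with `(A)_{𝔪_O ∩ A}` regular of dimension `n + 1 ≤ N + 1`, every finite
  `Z ⊆ A` is monomialized on some finitely generated `A ⊆ A' ⊆ O` regular at the centre of `O`.  Proof: the bottleneck
  ✓ `exists_localRing_monomial_of_embeddedResolution_gen` (hand-2 g2; = the tree's `exists_localRing_monomial_of_embeddedResolution` with the
  dimension bound a parameter) monomializes the ONE element `s · ∏_{z ∈ Z, z ≠ 0} z` (`0 ≠ s ∈ 𝔪`) on the local ring of `A[u]` at the centre;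
  divisors of a unit times a monomial in a regular system of parameters are again such (✓ `CossartPiltantMonomial.exists_eq_units_mul_prod_pow_of_dvd`);
  the model bookkeeping (`A' = A[u]`, `locAtCentre A' O = ` the image of the bottleneck's local ring) is that of ✓ `cleanLU_dim_of_isMin_pthPowerApprox`
  token for token.  No zero-dimensionality, `Frac A = K` or `dim A ≤ d` hypothesis is used.

Consequently ✓ `cleanModels_dim_of_embeddedResolution n hEmb hND hZ` (hand-2 g2) is the special case
`cleanModels_dim_of_localMonomialization n (localMonomialization_of_embeddedResolution n hEmb …) hND hZ` of this seat's graded reduction, and the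
census of stub 7 reads: `CleanModels(dim d) ⟸ hMono_d ∧ hND_d ∧ hZ_d` with `hMono_d ⟸ hEmb_{d−1}` (open, `d ≥ 4`) or, at Abhyankar places with
separable residue field, ⟸ Knaf–Kuhlmann 2005 Thm. 1.1 (print; `KnafKuhlmann2005_Thm11_monomialForm`).  Structural bookkeeping, counted 0.
-/

noncomputable section

set_option linter.dupNamespace false -- mandated namespace of this single-conjunct summit

open IsLocalRing AlgebraicGeometry CategoryTheory
open Literature.AlgebraicGeometry.Resolution Literature.AlgebraicGeometry.Motives

namespace Summit.ResolutionOfSingularities.ResolutionOfSingularities.Theorems.RadicialJung.CleanModels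

/-- **Local monomialization of a finite subset of a regular model along a valuation, dimension `n + 1`, modulo embedded resolution of closed
subsets of dimension `≤ N` (`n ≤ N`) of regular excellent schemes.**  Setting: `K ⊇ k` a function field, `O` a valuation ring of `K`, `A ⊆ O` a
finitely generated `k`-subalgebra whose local ring at the centre of `O` is regular of dimension `n + 1`, `Z ⊆ A` finite (neither `Frac A = K`
nor zero-dimensionality of `O` over `A` is needed).
Conclusion: a finitely generated `A ⊆ A' ⊆ O` with `(A')_{𝔪_O ∩ A'}` regular, a regular system of parameters `(aᵢ)_{i < e}` of it
(`e = dim`), and for every non-zero `z ∈ Z` a unit `v` and exponents `μ` with `z = v ∏ aᵢ^{μᵢ}` — the hypothesis shape `hMono_{n+1}` of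
`cleanModels_dim_of_localMonomialization` (`…DimOfLocalMonomialization.lean`).  Mechanism: monomialize the single element `s ∏_{z ≠ 0} z`
(`0 ≠ s ∈ 𝔪`) by ✓ `exists_localRing_monomial_of_embeddedResolution_gen` and split the monomial among its divisors.
[cite: CossartJannsenSaito2020, Cor. 1.5, p. 7] [cite: CossartPiltant2008, Prop. 4.1] -/
theorem localMonomialization_of_embeddedResolution (N : ℕ)
    (hEmb : ∀ (Z : Scheme.{0}) [IsIntegral Z] [IsNoetherian Z], Scheme.IsRegular Z →
      Scheme.IsExcellent Z → ∀ (X : Set Z), IsClosed X → X ≠ Set.univ → topologicalKrullDim X ≤ N →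
        ∃ (Z' : Scheme.{0}) (π : Z' ⟶ Z), IsProper π ∧ Function.Surjective π.base ∧
          (∃ U : Z.Opens, (U : Set Z) = Xᶜ ∧ IsIso (π ∣_ U)) ∧
          IsStrictNormalCrossingsDivisor Z' (π.base ⁻¹' X))
    {n : ℕ} (hn : n ≤ N)
    (k : Type) [Field k] (K : Type) [Field K] [Algebra k K]
    (O : ValuationSubring K) (A : Subalgebra k K) (hAO : A.toSubring ≤ O.toSubring) (hAfg : A.FG)
    (hreg : IsRegularLocalRing (locAtCentre A.toSubring O))
    (hdim : ringKrullDim (locAtCentre A.toSubring O) = (n + 1 : ℕ))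
    (Z : Finset K) (hZ : ∀ z ∈ Z, z ∈ A) :
    ∃ (A' : Subalgebra k K), A'.toSubring ≤ O.toSubring ∧ A ≤ A' ∧ A'.FG ∧
    ∃ (_ : IsRegularLocalRing (locAtCentre A'.toSubring O)) (e : ℕ) (a : Fin e → ↥(locAtCentre A'.toSubring O)),
      Ideal.span (Set.range a) = IsLocalRing.maximalIdeal ↥(locAtCentre A'.toSubring O) ∧
      ringKrullDim ↥(locAtCentre A'.toSubring O) = (e : WithBot ℕ∞) ∧
      ∀ z ∈ Z, z ≠ 0 → ∃ (v : ↥(locAtCentre A'.toSubring O)) (μ : Fin e → ℕ), IsUnit v ∧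
        z = (v : K) * ∏ i, ((a i : ↥(locAtCentre A'.toSubring O)) : K) ^ (μ i) := by
  classical
  haveI := hreg
  set S : Subring K := locAtCentre A.toSubring O with hSdef
  have hSO : S ≤ O.toSubring := locAtCentre_le hAO
  have hAS : A.toSubring ≤ S := le_locAtCentre A.toSubring O
  haveI : IsDomain S := inferInstance
  -- `S` is excellent: a localisation of the finitely generated `k`-algebra `A`
  haveI : Algebra.FiniteType k A := (Subalgebra.fg_iff_finiteType A).mp hAfg
  have hexcA : IsExcellentRing A := isExcellentRing_of_finiteType_field k A
  haveI := isLocalization_locAtCentre (K := K) (O := O) hAO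
  have hexcS : IsExcellentRing S :=
    IsExcellentRing.of_isLocalization (A := A.toSubring) (B := S) (subringCentre A.toSubring O hAO).primeCompl hexcA
  -- a non-zero element `s` of the maximal ideal
  have hmne : maximalIdeal S ≠ ⊥ := by
    intro hbot
    have hfield : IsField S := IsLocalRing.isField_iff_maximalIdeal_eq.mpr hbot
    have h0 : ringKrullDim S = 0 := ringKrullDim_eq_zero_of_isField hfield
    have h3 : ringKrullDim S = (n + 1 : ℕ) := hdim
    rw [h0] at h3
    have h3' : ((0 : ℕ) : WithBot ℕ∞) = ((n + 1 : ℕ) : WithBot ℕ∞) := by exact_mod_cast h3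
    have h3'' : (0 : ℕ) = n + 1 := by exact_mod_cast h3'
    omega
  obtain ⟨s, hsm, hs0⟩ := Submodule.exists_mem_ne_zero_of_ne_bot hmne
  -- the one element to monomialize: `s` times the product of the non-zero elements of `Z`
  let Z₀ : Finset K := Z.filter (fun z => z ≠ 0)
  have hZ₀ : ∀ z ∈ Z₀, z ∈ A ∧ z ≠ 0 := fun z hz =>
    ⟨hZ z (Finset.mem_filter.mp hz).1, (Finset.mem_filter.mp hz).2⟩
  let ι : ↥Z₀ → S := fun w => ⟨(w : K), hAS (hZ₀ w.1 w.2).1⟩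
  let xR : S := s * ∏ w : ↥Z₀, ι w
  have hprod0 : (∏ w : ↥Z₀, ι w) ≠ 0 :=
    Finset.prod_ne_zero_iff.mpr fun w _ h => (hZ₀ w.1 w.2).2 (congrArg Subtype.val h)
  have hxR0 : xR ≠ 0 := mul_ne_zero hs0 hprod0
  have hxRm : xR ∈ maximalIdeal S := Ideal.mul_mem_right _ _ hsm
  -- domination of `S` by `O`
  have hRO : ∀ r : S, algebraMap S K r ∈ O := fun r => hSO r.2
  have hRm : ∀ r : S, r ∈ maximalIdeal S ↔ O.valuation (algebraMap S K r) < 1 := fun r =>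
    mem_maximalIdeal_locAtCentre_iff hAO r
  -- MONOMIALIZE `xR` along `v` (embedded resolution)
  obtain ⟨uu, -, huuO, R', _, _, _, hinj, hR'O, hR'm, hlow, hup, d, z, α, u, hu, hdimR', hspan, hfact⟩ :=
    exists_localRing_monomial_of_embeddedResolution_gen N hn hEmb (R := S) (K := K) (E := K) Subtype.val_injective hexcS
      hdim O hRO hRm xR hxR0 hxRm
  -- the subring `T = S[uu]` and the image `R₂ = locAtCentre T O` of `R'`
  let T : Subring K := (Algebra.adjoin S (uu : Set K)).toSubring
  have hTO : T ≤ O.toSubring := fun w hw => huuO w hw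
  have hST : S ≤ T := fun w hw => (Algebra.adjoin S (uu : Set K)).algebraMap_mem (⟨w, hw⟩ : S)
  have hTR : ∀ w ∈ T, w ∈ Set.range (algebraMap R' K) := fun w hw => hlow w hw
  set R₂ : Subring K := locAtCentre T O with hR₂def
  have hrange : (algebraMap R' K).range = R₂ := range_eq_locAtCentre (algebraMap R' K) O T hTR hR'm hup
  obtain ⟨hreg₂, z₂, u₂, hz₂, hu₂K, hspan₂, hdim₂, hu₂⟩ :=
    regular_data_of_range_eq (algebraMap R' K) hinj R₂ hrange z hspan hdimR' u hu
  haveI := hreg₂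
  have hTR₂ : T ≤ R₂ := le_locAtCentre T O
  -- `z₂` is a regular system of parameters of `R₂`
  have hd' : (maximalIdeal R₂).spanFinrank = d := by
    have h := IsRegularLocalRing.spanFinrank_maximalIdeal (R := R₂)
    rw [hdim₂] at h
    exact_mod_cast h
  have hzr : IsRsopPart z₂ := isRsopPart_comp_of_rsop hd' z₂ hspan₂ id Function.injective_id
  -- `xR = u₂ ∏ z₂^α` in `R₂`
  let xR₂ : R₂ := ⟨(xR : K), hTR₂ (hST xR.2)⟩
  have hfact₂ : xR₂ = u₂ * ∏ i, z₂ i ^ α i := by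
    apply Subtype.ext
    have h2 : ((u₂ * ∏ i, z₂ i ^ α i : R₂) : K) = (u₂ : K) * ∏ i, (z₂ i : K) ^ α i := by
      push_cast; rfl
    have h3 : algebraMap S K xR = ((xR₂ : R₂) : K) := rfl
    have h4 : algebraMap R' K (u * ∏ i, z i ^ α i) = (u₂ : K) * ∏ i, (z₂ i : K) ^ α i := by
      rw [map_mul, map_prod, ← hu₂K]
      simp_rw [map_pow, ← hz₂]
    rw [h2, ← h4, ← hfact, h3]
  -- `xR₂ = s₂ · ∏ ι₂ w` in `R₂`
  let s₂ : R₂ := ⟨(s : K), hTR₂ (hST s.2)⟩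
  let ι₂ : ↥Z₀ → R₂ := fun w => ⟨(w : K), hTR₂ (hST (hAS (hZ₀ w.1 w.2).1))⟩
  have hxR₂ : xR₂ = s₂ * ∏ w : ↥Z₀, ι₂ w := by
    apply Subtype.ext
    change (((s * ∏ w : ↥Z₀, ι w : S)) : K) = ((s₂ * ∏ w : ↥Z₀, ι₂ w : R₂) : K)
    push_cast
    rfl
  -- the finitely generated model `A' = A[uu]`
  let A' : Subalgebra k K :=
    { Subring.closure ((A.toSubring : Set K) ∪ ↑uu) with
      algebraMap_mem' := fun r => Subring.subset_closure (Or.inl (A.algebraMap_mem r)) }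
  have hA'sub : A'.toSubring = Subring.closure ((A.toSubring : Set K) ∪ ↑uu) := rfl
  have hAA' : A ≤ A' := fun w hw => Subring.subset_closure (Or.inl hw)
  have huuO' : ∀ w ∈ (uu : Set K), w ∈ O := fun w hw => huuO w (Algebra.subset_adjoin hw)
  have hA'O : A'.toSubring ≤ O.toSubring := by
    rw [hA'sub, Subring.closure_le]
    rintro w (hw | hw)
    · exact hAO hw
    · exact huuO' w hw
  have hA'fg : A'.FG := by
    obtain ⟨s₀, hs₀⟩ := hAfg
    refine ⟨s₀ ∪ uu, le_antisymm ?_ ?_⟩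
    · rw [Algebra.adjoin_le_iff]
      rintro w hw
      rw [Finset.coe_union] at hw
      rcases hw with hw | hw
      · exact hAA' (hs₀ ▸ Algebra.subset_adjoin hw)
      · exact Subring.subset_closure (Or.inr hw)
    · intro w hw
      change w ∈ Subring.closure ((A.toSubring : Set K) ∪ ↑uu) at hw
      have hle : Subring.closure ((A.toSubring : Set K) ∪ ↑uu) ≤ (Algebra.adjoin k (↑(s₀ ∪ uu) : Set K)).toSubring := by
        rw [Subring.closure_le]
        rintro v (hv | hv)
        · have : v ∈ Algebra.adjoin k (s₀ : Set K) := by rw [hs₀]; exact hv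
          exact Algebra.adjoin_mono (by rw [Finset.coe_union]; exact Set.subset_union_left) this
        · exact Algebra.subset_adjoin (by rw [Finset.coe_union]; exact Or.inr hv)
      exact hle hw
  -- `R₂ = locAtCentre A' O`
  have hT : T = Subring.closure ((S : Set K) ∪ ↑uu) := by
    change (Algebra.adjoin S (uu : Set K)).toSubring = _
    rw [Algebra.adjoin_eq_ring_closure]
    congr 1
    ext w
    simp only [Set.mem_union, Set.mem_range, SetLike.mem_coe]
    constructor
    · rintro (⟨r, rfl⟩ | h)
      · exact Or.inl r.2
      · exact Or.inr h
    · rintro (h | h)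
      · exact Or.inl ⟨⟨w, h⟩, rfl⟩
      · exact Or.inr h
  have hR₂A' : R₂ = locAtCentre A'.toSubring O := by
    rw [hR₂def, hT, hSdef, PfaffLine.locAtCentre_closure_locAtCentre_union, hA'sub]
  -- assemble: every non-zero `w ∈ Z` divides `xR₂ = u₂ ∏ z₂^α`, hence is a unit times a monomial
  refine ⟨A', hA'O, hAA', hA'fg, ?_⟩
  rw [← hR₂A']
  refine ⟨hreg₂, d, z₂, hspan₂, hdim₂, fun w hw hw0 => ?_⟩
  have hw₀ : w ∈ Z₀ := Finset.mem_filter.mpr ⟨hw, hw0⟩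
  have hdvd : ι₂ ⟨w, hw₀⟩ ∣ xR₂ := by
    rw [hxR₂]
    exact Dvd.dvd.mul_left (Finset.dvd_prod_of_mem ι₂ (Finset.mem_univ (⟨w, hw₀⟩ : ↥Z₀))) s₂
  have hdvd' : ι₂ ⟨w, hw₀⟩ ∣ ∏ i, z₂ i ^ α i := by
    refine (hu₂.dvd_mul_left).mp ?_
    rw [← hfact₂]
    exact hdvd
  obtain ⟨c, β, hc⟩ := CossartPiltantMonomial.exists_eq_units_mul_prod_pow_of_dvd (fun i => hzr.prime i) α hdvd'
  refine ⟨(c : R₂), β, Units.isUnit c, ?_⟩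
  have := congrArg (fun r : R₂ => (r : K)) hc
  simpa using this

end Summit.ResolutionOfSingularities.ResolutionOfSingularities.Theorems.RadicialJung.CleanModels

end
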